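import Summits.Ventures.DiscreteObjects.Hadamard.CompositeOrderRank

/-!
# Hadamard 668 census, family F12 — no automorphism of order 253 or 115 of a Hadamard matrix of order 668; order 161 forces the fixed-point-free type (kernel)

Framing: lottery ticket; floor = certified bounds/negative ranges.

Cell pub-namedobj (venture DiscreteObjects), target (H), hadamard gen 11 (HANDOFF-H-g10 item 0 = FAMILY-F12-G10 §8(m), new
frame-free proof; refines census line (4), whose prime-order spectrum is `{2,3,5,7,11,13,23,37,41,83,167}`, by COMPOSITE orders).
For a signed-permutation automorphism `(π, κ, d, e)` of a Hadamard matrix of order `668` whose permutation pair has order `23·q`: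
after re-signing (`exists_resign_of_odd`, `23q` odd) the counting constraints of `CompositeOrderRank.structure_cols` (rows and
columns) and, in the 24-type, the rank inequality `ineq_24type` give:
* **`no_hadamard668_signedAut_order253`** (`q = 11`; counting alone: the `11`-part would have to fix `≥ 6` resp. `≥ 7` whole
  `23`-orbits, i.e. `> 60` columns);
* **`no_hadamard668_signedAut_order115`** (`q = 5`; fixed-point-free type: `93` fixed columns is not `668 − 5m` with `m` even;
  24-type: counting leaves `f'_r ∈ {9, 19}`, `x₁ = 69`, and the rank inequality `552 + 92 f'_r ≤ 920` fails);
* `order161_forces_fpf` (`q = 7`; 24-type: `x₁ = 0`, `f'_r ≥ 3` against `552 + 138 f'_r ≤ 644`; so the `23`-part is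
  fixed-point-free — `1 + 1` fixed — and the `7`-part fixes exactly `24 = 1 + 23` rows and columns, one whole `23`-orbit each):
  the input of the final exclusion of order `161` (`CompositeOrder161`, the PAF lemma of FAMILY-F12-G10 §8(m));
and the `orderOf` forms `no_hadamard668_signedAut_orderOf_253 / _115` (order of `(π, κ)` in `Perm × Perm`).
So **no Hadamard matrix of order 668 has an automorphism of order 253 or 115** (for a signed permutation pair `(P, Q)` of odd
order its permutation part has the same order).  Ours, not literature; no `sorry`.
-/

namespace Summit.Ventures.DiscreteObjects.Hadamard

open Finset BigOperators Matrix

open Literature.Combinatorics.Designs.GoethalsSeidel (IsHadamardMatrix)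

variable {ι : Type*} [Fintype ι] [DecidableEq ι]

section arithmetic

/-- `q = 11`: the counting constraints are contradictory (both types) -/
lemma arith_11 (fσ fh x1 fp m : ℕ) (hfix : fσ = 1 ∨ fσ = 24) (h2 : 2 ∣ m) (hm : fh + m * 11 = 668)
    (hlo : 56 ≤ m) (hhi : m ≤ 60) (hsplit : fh = x1 + fp) (hdvd : 23 ∣ x1) (hmod : fp % 11 = fσ % 11)
    (hle : fp ≤ fσ) : False := by
  obtain ⟨t, rfl⟩ := h2
  obtain ⟨k, rfl⟩ := hdvd
  have hk : k ≤ 2 := by omega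
  rcases hfix with rfl | rfl <;> interval_cases k <;> omega

/-- `q = 5`, fixed-point-free type: contradictory (`93` fixed columns would need `m = 115`, odd) -/
lemma arith_5_fpf (fh x1 fp m : ℕ) (h2 : 2 ∣ m) (hm : fh + m * 5 = 668)
    (hlo : 112 ≤ m) (hhi : m ≤ 132) (hsplit : fh = x1 + fp) (hdvd : 23 ∣ x1) (hmod : fp % 5 = 1 % 5)
    (hle : fp ≤ 1) : False := by
  obtain ⟨t, rfl⟩ := h2
  obtain ⟨k, rfl⟩ := hdvd
  have hk : k ≤ 4 := by omega
  interval_cases k <;> omega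

/-- `q = 5`, 24-type: `x₁ = 69` and `f' ∈ {9, 19}` -/
lemma arith_5_24 (fh x1 fp m : ℕ) (h2 : 2 ∣ m) (hm : fh + m * 5 = 668)
    (hlo : 112 ≤ m) (hhi : m ≤ 132) (hsplit : fh = x1 + fp) (hdvd : 23 ∣ x1) (hmod : fp % 5 = 24 % 5)
    (hle : fp ≤ 24) : x1 = 69 ∧ (fp = 9 ∨ fp = 19) := by
  obtain ⟨t, rfl⟩ := h2
  obtain ⟨k, rfl⟩ := hdvd
  have hk : k ≤ 4 := by omega
  interval_cases k <;> omega

/-- `q = 7`, 24-type: `x₁ = 0` and `f' ≥ 3` -/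
lemma arith_7_24 (fh x1 fp m : ℕ) (h2 : 2 ∣ m) (hm : fh + m * 7 = 668)
    (hlo : 84 ≤ m) (hhi : m ≤ 94) (hsplit : fh = x1 + fp) (hdvd : 23 ∣ x1) (hmod : fp % 7 = 24 % 7)
    (hle : fp ≤ 24) : x1 = 0 ∧ 3 ≤ fp := by
  obtain ⟨t, rfl⟩ := h2
  obtain ⟨k, rfl⟩ := hdvd
  have hk : k ≤ 3 := by omega
  interval_cases k <;> omega

/-- `q = 7`, fixed-point-free type: `x₁ = 23`, `f' = 1`, `24` fixed in all -/
lemma arith_7_fpf (fh x1 fp m : ℕ) (h2 : 2 ∣ m) (hm : fh + m * 7 = 668)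
    (hlo : 84 ≤ m) (hhi : m ≤ 94) (hsplit : fh = x1 + fp) (hdvd : 23 ∣ x1) (hmod : fp % 7 = 1 % 7)
    (hle : fp ≤ 1) : x1 = 23 ∧ fp = 1 ∧ fh = 24 := by
  obtain ⟨t, rfl⟩ := h2
  obtain ⟨k, rfl⟩ := hdvd
  have hk : k ≤ 3 := by omega
  interval_cases k <;> omega

/-- `q = 5`, 24-type: the rank inequality fails -/
lemma arith_5_rank (q fr x1 : ℕ) (hq : q = 5) (hx : x1 = 69) (hf : fr = 9 ∨ fr = 19)
    (ineq : (24 * 23 + (fr : ℤ) * (23 * (q : ℤ) - 23) : ℤ) ≤ 644 + (x1 : ℤ) * ((q : ℤ) - 1)) : False := by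
  subst hq; push_cast at ineq; omega

/-- `q = 7`, 24-type: the rank inequality fails -/
lemma arith_7_rank (q fr x1 : ℕ) (hq : q = 7) (hx : x1 = 0) (hf : 3 ≤ fr)
    (ineq : (24 * 23 + (fr : ℤ) * (23 * (q : ℤ) - 23) : ℤ) ≤ 644 + (x1 : ℤ) * ((q : ℤ) - 1)) : False := by
  subst hq; push_cast at ineq; omega

end arithmetic

section results
variable {H : Matrix ι ι ℤ} {π κ : Equiv.Perm ι}

/-- **Order 253 (= 11 · 23), unsigned form.** -/
theorem no_unsignedAut_order253 (hH : IsHadamardMatrix H) (hι : Fintype.card ι = 668)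
    (hA : ∀ i j, H (π i) (κ j) = H i j) (hπ : π ^ 253 = 1) (hκ : κ ^ 253 = 1)
    (hσ : π ^ 11 ≠ 1 ∨ κ ^ 11 ≠ 1) (hh : π ^ 23 ≠ 1 ∨ κ ^ 23 ≠ 1) : False := by
  have hπ' : π ^ (23 * 11) = 1 := by rw [show (23 : ℕ) * 11 = 253 from rfl]; exact hπ
  have hκ' : κ ^ (23 * 11) = 1 := by rw [show (23 : ℕ) * 11 = 253 from rfl]; exact hκ
  obtain ⟨hfix, -, ⟨m, h2, hm, -, -, w11⟩, hsplit, hdvd, hmod, hle⟩ :=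
    structure_cols hH hι hA (q := 11) (by norm_num) hπ' hκ' hσ hh
  obtain ⟨hlo, hhi⟩ := w11 rfl
  exact arith_11 _ _ _ _ _ hfix h2 hm hlo hhi hsplit hdvd hmod hle


/-- **Order 115 (= 5 · 23), unsigned form.** -/
theorem no_unsignedAut_order115 (hH : IsHadamardMatrix H) (hι : Fintype.card ι = 668)
    (hA : ∀ i j, H (π i) (κ j) = H i j) (hπ : π ^ 115 = 1) (hκ : κ ^ 115 = 1)
    (hσ : π ^ 5 ≠ 1 ∨ κ ^ 5 ≠ 1) (hh : π ^ 23 ≠ 1 ∨ κ ^ 23 ≠ 1) : False := by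
  have hcard : (Fintype.card ι : ℤ) ≠ 0 := by rw [hι]; norm_num
  have hπ' : π ^ (23 * 5) = 1 := by rw [show (23 : ℕ) * 5 = 115 from rfl]; exact hπ
  have hκ' : κ ^ (23 * 5) = 1 := by rw [show (23 : ℕ) * 5 = 115 from rfl]; exact hκ
  obtain ⟨hfix, hrc, ⟨m, h2, hm, w5, -, -⟩, hsplit, hdvd, hmod, hle⟩ :=
    structure_cols hH hι hA (q := 5) (by norm_num) hπ' hκ' hσ hh
  obtain ⟨hlo, hhi⟩ := w5 rfl
  obtain ⟨hfix', hrc', ⟨m', h2', hm', w5', -, -⟩, hsplit', hdvd', hmod', hle'⟩ :=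
    structure_cols (isHadamard_transpose hH hcard) hι (unsigned_transpose hA) (q := 5) (by norm_num) hκ' hπ'
      hσ.symm hh.symm
  obtain ⟨hlo', hhi'⟩ := w5' rfl
  rcases hfix with h1 | h24
  · rw [h1] at hmod hle
    exact arith_5_fpf _ _ _ _ h2 hm hlo hhi hsplit hdvd hmod hle
  · have h24r : (univ.filter fun i => (π ^ 5) i = i).card = 24 := by rw [hrc, h24]
    rw [h24r] at hmod' hle'
    rw [h24] at hmod hle
    obtain ⟨hx, -⟩ := arith_5_24 _ _ _ _ h2 hm hlo hhi hsplit hdvd hmod hle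
    obtain ⟨-, hf⟩ := arith_5_24 _ _ _ _ h2' hm' hlo' hhi' hsplit' hdvd' hmod' hle'
    exact arith_5_rank 5 _ _ rfl hx hf (ineq_24type hH hι hA (q := 5) (by norm_num) hπ' hκ' h24r h24)

/-- **Order 161 (= 7 · 23) forces the fixed-point-free type**: for an unsigned automorphism pair of order `161` the
`23`-part `(π^7, κ^7)` fixes exactly one row and one column, and the `7`-part `(π^23, κ^23)` fixes exactly `24` rows and
`24` columns, `23` of them moved by the `23`-part (one whole `23`-orbit on each side). -/
theorem order161_forces_fpf (hH : IsHadamardMatrix H) (hι : Fintype.card ι = 668)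
    (hA : ∀ i j, H (π i) (κ j) = H i j) (hπ : π ^ 161 = 1) (hκ : κ ^ 161 = 1)
    (hσ : π ^ 7 ≠ 1 ∨ κ ^ 7 ≠ 1) (hh : π ^ 23 ≠ 1 ∨ κ ^ 23 ≠ 1) :
    (univ.filter fun i => (π ^ 7) i = i).card = 1 ∧ (univ.filter fun j => (κ ^ 7) j = j).card = 1 ∧
    (univ.filter fun i => (π ^ 23) i = i).card = 24 ∧ (univ.filter fun j => (κ ^ 23) j = j).card = 24 ∧
    (univ.filter fun i => (π ^ 7) i ≠ i ∧ (π ^ 23) i = i).card = 23 ∧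
    (univ.filter fun j => (κ ^ 7) j ≠ j ∧ (κ ^ 23) j = j).card = 23 := by
  have hcard : (Fintype.card ι : ℤ) ≠ 0 := by rw [hι]; norm_num
  have hπ' : π ^ (23 * 7) = 1 := by rw [show (23 : ℕ) * 7 = 161 from rfl]; exact hπ
  have hκ' : κ ^ (23 * 7) = 1 := by rw [show (23 : ℕ) * 7 = 161 from rfl]; exact hκ
  obtain ⟨hfix, hrc, ⟨m, h2, hm, -, w7, -⟩, hsplit, hdvd, hmod, hle⟩ :=
    structure_cols hH hι hA (q := 7) (by norm_num) hπ' hκ' hσ hh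
  obtain ⟨hlo, hhi⟩ := w7 rfl
  obtain ⟨hfix', hrc', ⟨m', h2', hm', -, w7', -⟩, hsplit', hdvd', hmod', hle'⟩ :=
    structure_cols (isHadamard_transpose hH hcard) hι (unsigned_transpose hA) (q := 7) (by norm_num) hκ' hπ'
      hσ.symm hh.symm
  obtain ⟨hlo', hhi'⟩ := w7' rfl
  rcases hfix with h1 | h24
  · have h1r : (univ.filter fun i => (π ^ 7) i = i).card = 1 := by rw [hrc, h1]
    rw [h1r] at hmod' hle'
    rw [h1] at hmod hle
    obtain ⟨hx, -, hfh⟩ := arith_7_fpf _ _ _ _ h2 hm hlo hhi hsplit hdvd hmod hle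
    obtain ⟨hx', -, hfh'⟩ := arith_7_fpf _ _ _ _ h2' hm' hlo' hhi' hsplit' hdvd' hmod' hle'
    exact ⟨h1r, h1, hfh', hfh, hx', hx⟩
  · exfalso
    have h24r : (univ.filter fun i => (π ^ 7) i = i).card = 24 := by rw [hrc, h24]
    rw [h24r] at hmod' hle'
    rw [h24] at hmod hle
    obtain ⟨hx, -⟩ := arith_7_24 _ _ _ _ h2 hm hlo hhi hsplit hdvd hmod hle
    obtain ⟨-, hf⟩ := arith_7_24 _ _ _ _ h2' hm' hlo' hhi' hsplit' hdvd' hmod' hle'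
    exact arith_7_rank 7 _ _ rfl hx hf (ineq_24type hH hι hA (q := 7) (by norm_num) hπ' hκ' h24r h24)

/-- re-signing: a signed automorphism of odd order `n` yields a permutation automorphism of an equivalent Hadamard matrix -/
lemma exists_unsigned_of_signedAut (hH : IsHadamardMatrix H) {d e : ι → ℤ} (haut : IsSignedAut H π κ d e)
    {n : ℕ} (hodd : Odd n) (hπ : π ^ n = 1) (hκ : κ ^ n = 1) :
    ∃ H' : Matrix ι ι ℤ, IsHadamardMatrix H' ∧ ∀ i j, H' (π i) (κ j) = H' i j := by
  obtain ⟨s, t, -, -, hH', hrel⟩ := exists_resign_of_odd hH haut hodd hπ hκ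
  exact ⟨Matrix.of fun i j => s i * t j * H i j, hH', fun i j => by simpa only [Matrix.of_apply] using hrel i j⟩

/-- **No Hadamard matrix of order 668 has a signed automorphism `(π, κ, d, e)` whose permutation pair has order `253`:**
`π^253 = κ^253 = 1` with `(π^11, κ^11) ≠ (1, 1)` and `(π^23, κ^23) ≠ (1, 1)` is impossible. -/
theorem no_hadamard668_signedAut_order253 (hH : IsHadamardMatrix H) (hι : Fintype.card ι = 668)
    (π κ : Equiv.Perm ι) (d e : ι → ℤ) (haut : IsSignedAut H π κ d e) (hπ : π ^ 253 = 1) (hκ : κ ^ 253 = 1)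
    (hσ : π ^ 11 ≠ 1 ∨ κ ^ 11 ≠ 1) (hh : π ^ 23 ≠ 1 ∨ κ ^ 23 ≠ 1) : False := by
  obtain ⟨H', hH', hA⟩ := exists_unsigned_of_signedAut hH haut (by decide : Odd 253) hπ hκ
  exact no_unsignedAut_order253 hH' hι hA hπ hκ hσ hh

/-- **No Hadamard matrix of order 668 has a signed automorphism `(π, κ, d, e)` whose permutation pair has order `115`:**
`π^115 = κ^115 = 1` with `(π^5, κ^5) ≠ (1, 1)` and `(π^23, κ^23) ≠ (1, 1)` is impossible. -/
theorem no_hadamard668_signedAut_order115 (hH : IsHadamardMatrix H) (hι : Fintype.card ι = 668)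
    (π κ : Equiv.Perm ι) (d e : ι → ℤ) (haut : IsSignedAut H π κ d e) (hπ : π ^ 115 = 1) (hκ : κ ^ 115 = 1)
    (hσ : π ^ 5 ≠ 1 ∨ κ ^ 5 ≠ 1) (hh : π ^ 23 ≠ 1 ∨ κ ^ 23 ≠ 1) : False := by
  obtain ⟨H', hH', hA⟩ := exists_unsigned_of_signedAut hH haut (by decide : Odd 115) hπ hκ
  exact no_unsignedAut_order115 hH' hι hA hπ hκ hσ hh

omit [Fintype ι] [DecidableEq ι] in
/-- from `orderOf (π, κ) = a * b`: `π^(ab) = κ^(ab) = 1` and the pair `(π^a, κ^a)` is nontrivial when `a < a b` -/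
lemma pow_data_of_orderOf {n a : ℕ} (h : orderOf ((π, κ) : Equiv.Perm ι × Equiv.Perm ι) = n) (ha : 0 < a)
    (han : a < n) : π ^ n = 1 ∧ κ ^ n = 1 ∧ (π ^ a ≠ 1 ∨ κ ^ a ≠ 1) := by
  have h1 : ((π, κ) : Equiv.Perm ι × Equiv.Perm ι) ^ n = 1 := by rw [← h]; exact pow_orderOf_eq_one _
  rw [Prod.pow_mk, Prod.mk_eq_one] at h1
  have h2 : ((π, κ) : Equiv.Perm ι × Equiv.Perm ι) ^ a ≠ 1 :=
    pow_ne_one_of_lt_orderOf (Nat.pos_iff_ne_zero.mp ha) (by rw [h]; exact han)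
  rw [Prod.pow_mk, Ne, Prod.mk_eq_one, not_and_or] at h2
  exact ⟨h1.1, h1.2, h2⟩

/-- **Order form.**  No Hadamard matrix of order `668` has a signed automorphism whose permutation pair `(π, κ)` has
order `253` in `Perm × Perm`. -/
theorem no_hadamard668_signedAut_orderOf_253 (hH : IsHadamardMatrix H) (hι : Fintype.card ι = 668)
    (π κ : Equiv.Perm ι) (d e : ι → ℤ) (haut : IsSignedAut H π κ d e)
    (h : orderOf ((π, κ) : Equiv.Perm ι × Equiv.Perm ι) = 253) : False := by
  obtain ⟨hπ, hκ, hσ⟩ := pow_data_of_orderOf h (a := 11) (by norm_num) (by norm_num)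
  obtain ⟨-, -, hh⟩ := pow_data_of_orderOf h (a := 23) (by norm_num) (by norm_num)
  exact no_hadamard668_signedAut_order253 hH hι π κ d e haut hπ hκ hσ hh

/-- **Order form.**  No Hadamard matrix of order `668` has a signed automorphism whose permutation pair `(π, κ)` has
order `115` in `Perm × Perm`. -/
theorem no_hadamard668_signedAut_orderOf_115 (hH : IsHadamardMatrix H) (hι : Fintype.card ι = 668)
    (π κ : Equiv.Perm ι) (d e : ι → ℤ) (haut : IsSignedAut H π κ d e)
    (h : orderOf ((π, κ) : Equiv.Perm ι × Equiv.Perm ι) = 115) : False := by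
  obtain ⟨hπ, hκ, hσ⟩ := pow_data_of_orderOf h (a := 5) (by norm_num) (by norm_num)
  obtain ⟨-, -, hh⟩ := pow_data_of_orderOf h (a := 23) (by norm_num) (by norm_num)
  exact no_hadamard668_signedAut_order115 hH hι π κ d e haut hπ hκ hσ hh

end results

end Summit.Ventures.DiscreteObjects.Hadamard
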